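import Summits.ValiantsHypothesis.ValiantsHypothesis.Theorems.LacunarySymmetroidMatrixDescartesCensusV20Model

/-!
# `MatrixDescartes` census — soundness of the `V = 20` certificate checker: signs and values of terms, the single-positive-term lemma

HONEST FRAMING.  Object-search cell `pub-symmetroid`; door-A item `DoorA26 = PosRootLawAt 2 6 19`
(stmt-ValiantsHypothesis-19979; OPEN, typed, never asserted).  Part of the proof that a certificate accepted by `V20.checkCell` (`…CensusV20Check`) excludes a twenty — `20 = D(2,6)` distinct
positive det-roots of a six-term real symmetric `2 × 2` pencil — on its support (semantics: `…CensusV20Model`).  Nothing here bears on `V = 19`, on `ζ_sym(2,6)` over all supports, on `DoorA26` itself, on `MatrixDescartes`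
(stmt-ValiantsHypothesis-18050) or on `VP ≠ VNP`.

[folklore] Certificate-checker soundness / replay; elementary.
-/

-- the D-0017 layout repeats a namespace component (single-conjunct summit); the `dupNamespace` linter flags it; name mandated.
set_option linter.dupNamespace false

namespace Summit.ValiantsHypothesis.ValiantsHypothesis.Theorems.LacunarySymmetroidMatrixDescartes.Census.V20

/-! ## Soundness, abstract layer: a MODEL of the rows (what a hypothetical twenty supplies) refutes every accepted certificate -/

section Model

open Finset

variable {dl : List ℕ} {ord : List Atom} {s : Bool}

/-! ### `posOf` -/

/-- An element of a list sits at a position below the length. [folklore] -/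
theorem posOf_lt_length {a : Atom} : ∀ {l : List Atom}, a ∈ l → posOf a l < l.length
  | [], h => by simp at h
  | b :: l, h => by
    unfold posOf
    split_ifs with hb
    · simp
    · have h' : a ∈ l := by
        rcases List.mem_cons.1 h with h | h
        · exact absurd h.symm hb
        · exact h
      have := posOf_lt_length h'
      simpa using this

/-- `posOf` finds the element. [folklore] -/
theorem getD_posOf {a dflt : Atom} : ∀ {l : List Atom}, a ∈ l → l.getD (posOf a l) dflt = a
  | [], h => by simp at h
  | b :: l, h => by
    unfold posOf
    split_ifs with hb
    · simpa using hb
    · have h' : a ∈ l := by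
        rcases List.mem_cons.1 h with h | h
        · exact absurd h.symm hb
        · exact h
      simpa using getD_posOf h'

/-! ### Signs of terms -/

/-- `lprod` of the empty list. [folklore] -/
theorem lprod_nil (x : ℕ → ℝ) : lprod x [] = 1 := by simp [lprod]

/-- `lprod` of a cons. [folklore] -/
theorem lprod_cons (x : ℕ → ℝ) (p : ℕ) (ps : List ℕ) : lprod x (p :: ps) = x p * lprod x ps := by
  simp [lprod]

/-- `lprod` is multiplicative. [folklore] -/
theorem lprod_append (x : ℕ → ℝ) (ps qs : List ℕ) : lprod x (ps ++ qs) = lprod x ps * lprod x qs := by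
  simp [lprod]

/-- `lprod` of positive values is positive. [folklore] -/
theorem lprod_pos {x : ℕ → ℝ} (hx : ∀ t, 0 < x t) (ps : List ℕ) : 0 < lprod x ps := by
  induction ps with
  | nil => simp [lprod]
  | cons p ps ih => rw [lprod_cons]; exact mul_pos (hx p) ih

/-- `lprod` of a constant list is a power. [folklore] -/
theorem lprod_replicate (x : ℕ → ℝ) (n p : ℕ) : lprod x (List.replicate n p) = x p ^ n := by
  induction n with
  | zero => simp [lprod]
  | succ n ih => rw [List.replicate_succ, lprod_cons, ih, pow_succ]; ring

/-- `lprod` of a flattened list. [folklore] -/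
theorem lprod_flatten (x : ℕ → ℝ) (L : List (List ℕ)) : lprod x L.flatten = (L.map (lprod x)).prod := by
  induction L with
  | nil => simp [lprod]
  | cons l L ih => rw [List.flatten_cons, lprod_append, ih, List.map_cons, List.prod_cons]

/-- The product of signed values splits into a parity sign and the product of absolute parts. [folklore] -/
theorem prod_map_sgn_mul (x : ℕ → ℝ) (s : Bool) (ord : List Atom) (A : List Atom) :
    (A.map fun a => sgnR s (posOf a ord) * x (posOf a ord)).prod
      = (if oddTrues (A.map fun a => negAt s (posOf a ord)) then -1 else 1) * lprod x (posl ord A) := by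
  induction A with
  | nil => simp [oddTrues, posl, lprod]
  | cons a A ih =>
    rw [List.map_cons, List.prod_cons, ih]
    simp only [List.map_cons, oddTrues, posl, lprod, List.prod_cons, sgnR]
    cases negAt s (posOf a ord) <;> cases oddTrues (List.map (fun a => negAt s (posOf a ord)) A) <;> simp

/-- Under a signed valuation, a term is `±|γ| · ∏ x` with the sign computed by `termNeg`. [folklore] -/
theorem tval_eq_of_model {x : ℕ → ℝ} {v : Atom → ℝ}
    (hv : ∀ a ∈ allAtoms, v a = sgnR s (posOf a ord) * x (posOf a ord))
    (T : Term) (hT : ∀ a ∈ T.2, a ∈ allAtoms) :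
    tval v T = (if termNeg ord s T then -1 else 1) * |(T.1 : ℝ)| * lprod x (posl ord T.2) := by
  unfold tval termNeg
  have hmap : T.2.map v = T.2.map fun a => sgnR s (posOf a ord) * x (posOf a ord) :=
    List.map_congr_left fun a ha => hv a (hT a ha)
  rw [hmap, prod_map_sgn_mul]
  have hg : (T.1 : ℝ) = (if decide (T.1 < 0) then -1 else 1) * |(T.1 : ℝ)| := by
    by_cases h : T.1 < 0
    · simp [h, abs_of_neg (show (T.1 : ℝ) < 0 by exact_mod_cast h)]
    · simp [h, abs_of_nonneg (show (0 : ℝ) ≤ T.1 by exact_mod_cast not_lt.1 h)]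
  rw [hg]
  cases decide (T.1 < 0) <;> cases oddTrues (List.map (fun a => negAt s (posOf a ord)) T.2) <;> simp

/-- Auxiliary step `tval_nonpos_of_termNeg` of the certificate-checker soundness proof. [folklore] -/
theorem tval_nonpos_of_termNeg {x : ℕ → ℝ} {v : Atom → ℝ} (hx : ∀ t, 0 < x t)
    (hv : ∀ a ∈ allAtoms, v a = sgnR s (posOf a ord) * x (posOf a ord))
    (T : Term) (hT : ∀ a ∈ T.2, a ∈ allAtoms) (hn : termNeg ord s T = true) :
    tval v T ≤ 0 := by
  rw [tval_eq_of_model hv T hT, hn]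
  simp only [ite_true]
  have := lprod_pos hx (posl ord T.2)
  have := abs_nonneg (T.1 : ℝ)
  nlinarith

/-- Auxiliary step `tval_eq_of_not_termNeg` of the certificate-checker soundness proof. [folklore] -/
theorem tval_eq_of_not_termNeg {x : ℕ → ℝ} {v : Atom → ℝ}
    (hv : ∀ a ∈ allAtoms, v a = sgnR s (posOf a ord) * x (posOf a ord))
    (T : Term) (hT : ∀ a ∈ T.2, a ∈ allAtoms) (hn : termNeg ord s T = false) :
    tval v T = |(T.1 : ℝ)| * lprod x (posl ord T.2) := by
  rw [tval_eq_of_model hv T hT, hn]; simp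

/-- Auxiliary step `abs_tval_eq` of the certificate-checker soundness proof. [folklore] -/
theorem abs_tval_eq {x : ℕ → ℝ} {v : Atom → ℝ} (hx : ∀ t, 0 < x t)
    (hv : ∀ a ∈ allAtoms, v a = sgnR s (posOf a ord) * x (posOf a ord))
    (T : Term) (hT : ∀ a ∈ T.2, a ∈ allAtoms) :
    |tval v T| = |(T.1 : ℝ)| * lprod x (posl ord T.2) := by
  rw [tval_eq_of_model hv T hT]
  have h1 := lprod_pos hx (posl ord T.2)
  split_ifs <;> simp [abs_mul, abs_of_pos h1]

/-! ### The valid polynomials use valid atoms -/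

/-- Membership in the atom list. [folklore] -/
theorem mem_allAtoms_iff (a : Atom) : a ∈ allAtoms ↔ a.1 ≤ a.2 ∧ a.2 < 6 := by
  obtain ⟨i, j⟩ := a
  constructor
  · intro h; simp [allAtoms] at h; omega
  · rintro ⟨h1, h2⟩
    have hi : i < 6 := by omega
    simp only [allAtoms]
    interval_cases j <;> interval_cases i <;> simp_all

/-- Diagonal atoms are atoms. [folklore] -/
theorem qA_mem {i : ℕ} (hi : i < 6) : qA i ∈ allAtoms := (mem_allAtoms_iff _).2 ⟨le_rfl, hi⟩

/-- Off-diagonal atoms are atoms. [folklore] -/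
theorem cA_mem {i j : ℕ} (hi : i < 6) (hj : j < 6) : cA i j ∈ allAtoms := by
  unfold cA; split_ifs with h
  · exact (mem_allAtoms_iff _).2 ⟨h, hj⟩
  · exact (mem_allAtoms_iff _).2 ⟨by omega, hi⟩

/-- The named inequalities only use valid atoms. [folklore] -/
theorem atoms_valid (P : PolySpec) (hP : P.valid = true) : ∀ T ∈ P.poly, ∀ a ∈ T.2, a ∈ allAtoms := by
  cases P with
  | g3 i j k =>
    simp only [PolySpec.valid, decide_eq_true_eq] at hP
    obtain ⟨h1, h2, h3⟩ := hP
    have hi : i < 6 := by omega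
    have hj : j < 6 := by omega
    intro T hT a ha
    simp only [PolySpec.poly, G3poly, List.mem_cons, List.not_mem_nil, or_false] at hT
    rcases hT with rfl | rfl | rfl | rfl | rfl <;> simp only [List.mem_cons, List.not_mem_nil, or_false] at ha <;>
      rcases ha with rfl | rfl | rfl <;> first | exact qA_mem ‹_› | exact cA_mem ‹_› ‹_›
  | rcs i j =>
    simp only [PolySpec.valid, decide_eq_true_eq] at hP
    obtain ⟨hi, hj, -⟩ := hP
    intro T hT a ha
    simp only [PolySpec.poly, RCSpoly, List.mem_cons, List.not_mem_nil, or_false] at hT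
    rcases hT with rfl | rfl <;> simp only [List.mem_cons, List.not_mem_nil, or_false] at ha <;>
      rcases ha with rfl | rfl <;> first | exact qA_mem ‹_› | exact cA_mem ‹_› ‹_›
  | w i j k l =>
    simp only [PolySpec.valid, decide_eq_true_eq] at hP
    obtain ⟨hi, hj, hk, hl, -⟩ := hP
    intro T hT a ha
    simp only [PolySpec.poly, Wpoly, List.mem_cons, List.not_mem_nil, or_false] at hT
    rcases hT with rfl | rfl | rfl | rfl | rfl | rfl | rfl | rfl | rfl | rfl | rfl | rfl | rfl | rfl <;>
      simp only [List.mem_cons, List.not_mem_nil, or_false] at ha <;>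
      rcases ha with rfl | rfl | rfl | rfl | rfl <;> first | exact qA_mem ‹_› | exact cA_mem ‹_› ‹_›

/-- All coefficients of the named polynomials are non-zero. [folklore] -/
theorem coeff_ne_zero (P : PolySpec) : ∀ T ∈ P.poly, T.1 ≠ 0 := by
  cases P <;> simp [PolySpec.poly, G3poly, RCSpoly, Wpoly]

variable {x : ℕ → ℝ} {v : Atom → ℝ}

/-- Auxiliary step `Model.v_qA_pos_iff` of the certificate-checker soundness proof. [folklore] -/
theorem Model.v_qA_pos_iff (M : Model dl ord s x v) {i : ℕ} (hi : i < 6) :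
    0 < v (qA i) ↔ negAt s (posOf (qA i) ord) = false := by
  rw [M.hv _ (qA_mem hi)]
  have hx := M.xpos (posOf (qA i) ord)
  unfold sgnR
  cases negAt s (posOf (qA i) ord) <;> simp [hx, hx.le]

/-! ### Valid atoms sit at positions `< 21` -/

/-- Valid atoms sit at positions `< 21`. [folklore] -/
theorem posOf_lt_21 (M : Model dl ord s x v) {a : Atom} (ha : a ∈ allAtoms) : posOf a ord < 21 := by
  have h := M.hord
  simp only [ordOK, Bool.and_eq_true, decide_eq_true_eq] at h
  obtain ⟨⟨⟨⟨-, hlen⟩, hall⟩, -⟩, -⟩ := h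
  have := posOf_lt_length (hall a ha)
  omega

/-- Positions of valid atoms are `< 21`. [folklore] -/
theorem posl_lt_21 (M : Model dl ord s x v) {A : List Atom} (hA : ∀ a ∈ A, a ∈ allAtoms) :
    ∀ p ∈ posl ord A, p < 21 := by
  intro p hp
  simp only [posl, List.mem_map] at hp
  obtain ⟨a, ha, rfl⟩ := hp
  exact posOf_lt_21 M (hA a ha)

/-! ### Single-positive polynomials -/

/-- Characterisation of the positive terms. [folklore] -/
theorem mem_posTerms_iff {P : List Term} {n : ℕ} (hn : n < P.length) :
    n ∈ posTerms ord s P ↔ termNeg ord s (P.getD n (0, [])) = false := by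
  unfold posTerms
  rw [List.mem_filter, List.mem_range, List.getD_eq_getElem?_getD, List.getElem?_eq_getElem hn]
  simp [hn]

/-- `pval` as a sum over indices. [folklore] -/
theorem pval_eq_sum_range (v : Atom → ℝ) (P : List Term) :
    pval v P = ∑ n ∈ Finset.range P.length, tval v (P.getD n (0, [])) := by
  unfold pval
  induction P with
  | nil => simp
  | cons T P ih =>
    rw [List.map_cons, List.sum_cons, ih, List.length_cons, Finset.sum_range_succ']
    simp [add_comm]

/-- A term of a polynomial, accessed by an index below the length, is a member. [folklore] -/
theorem term_getD_mem (P : List Term) {n : ℕ} (hn : n < P.length) : P.getD n (0, []) ∈ P := by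
  rw [List.getD_eq_getElem P (0, []) hn]; exact List.getElem_mem hn

/-- In a single-positive polynomial with `pval ≥ 0`, the negative terms over a duplicate-free index list `S`
(not containing the positive index) have total absolute value at most the positive term, which is `≥ 0`. [folklore] -/
theorem sum_abs_le_pos (M : Model dl ord s x v) (P : PolySpec) (hP : P.valid = true) {p : ℕ}
    (hpos : posTerms ord s P.poly = [p]) (hval : 0 ≤ pval v P.poly)
    (S : List ℕ) (hS : ∀ j ∈ S, j < P.poly.length ∧ j ≠ p) (hSnd : S.Nodup) :
    (S.map fun j => |tval v (P.poly.getD j (0, []))|).sum ≤ tval v (P.poly.getD p (0, [])) ∧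
      0 ≤ tval v (P.poly.getD p (0, [])) := by
  classical
  set w : ℕ → ℝ := fun n => tval v (P.poly.getD n (0, [])) with hw
  have hp : p < P.poly.length := by
    have : p ∈ posTerms ord s P.poly := by rw [hpos]; simp
    unfold posTerms at this
    exact List.mem_range.1 (List.mem_filter.1 this).1
  have hneg : ∀ n, n < P.poly.length → n ≠ p → w n ≤ 0 := by
    intro n hn hnp
    have hn' : n ∉ posTerms ord s P.poly := by rw [hpos]; simpa using hnp
    rw [mem_posTerms_iff hn] at hn'
    have htn : termNeg ord s (P.poly.getD n (0, [])) = true := by simpa using hn'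
    exact tval_nonpos_of_termNeg M.xpos M.hv _
      (fun a ha => atoms_valid P hP _ (term_getD_mem _ hn) a ha) htn
  set T := (Finset.range P.poly.length).erase p with hT
  have hsplit : pval v P.poly = w p + ∑ n ∈ T, w n := by
    rw [pval_eq_sum_range, ← Finset.add_sum_erase _ _ (Finset.mem_range.2 hp)]
  have hTnonpos : ∑ n ∈ T, w n ≤ 0 :=
    Finset.sum_nonpos fun n hn => by
      rw [hT, Finset.mem_erase, Finset.mem_range] at hn
      exact hneg n hn.2 hn.1
  have hsub : S.toFinset ⊆ T := by
    intro j hj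
    rw [List.mem_toFinset] at hj
    rw [hT, Finset.mem_erase, Finset.mem_range]
    exact ⟨(hS j hj).2, (hS j hj).1⟩
  have hTS : ∑ n ∈ T, w n ≤ ∑ n ∈ S.toFinset, w n := by
    have h := Finset.sum_le_sum_of_subset_of_nonneg (f := fun n => -w n) hsub (fun i hi hiS => by
      rw [hT, Finset.mem_erase, Finset.mem_range] at hi
      have := hneg i hi.2 hi.1
      linarith)
    rw [Finset.sum_neg_distrib, Finset.sum_neg_distrib] at h
    linarith
  have hSsum : ∑ n ∈ S.toFinset, w n = (S.map w).sum := (List.sum_toFinset w hSnd)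
  have habs : (S.map fun j => |w j|) = S.map fun j => -w j :=
    List.map_congr_left fun j hj => abs_of_nonpos (hneg j (hS j hj).1 (hS j hj).2)
  have hsumneg : ∀ L : List ℕ, (L.map fun j => -w j).sum = -(L.map w).sum := by
    intro L
    induction L with
    | nil => simp
    | cons a L ih => simp only [List.map_cons, List.sum_cons, ih]; ring
  refine ⟨?_, by linarith⟩
  show (S.map fun j => |w j|).sum ≤ w p
  rw [habs, hsumneg S]
  linarith

end Model

end Summit.ValiantsHypothesis.ValiantsHypothesis.Theorems.LacunarySymmetroidMatrixDescartes.Census.V20
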